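import Mathlib.FieldTheory.IsAlgClosed.AlgebraicClosure
import Mathlib.FieldTheory.Minpoly.Field
import Summits.KontsevichZagierPeriods.KontsevichZagierPeriods.Theorems.HurwitzMicroSectorsNormalFormPrincipleBoxRigidityDimOne

/-!
# `NormalFormPrinciple` (stmt-KontsevichZagierPeriods-3869), line `SketchIdeator1` —
# the leaf off the box in dimension one, I: box integrands with real algebraic coefficients

Pure proof file (lead seat c4; `--supports` the crux). The mixed-normal-form engine of the line
(`nfD_of_dvd`, seat c3) reduces a representation `[(0,1), P/Q]` with `P, Q ∈ K[X]`
(`K = algebraicClosure ℚ ℝ`, the real algebraic numbers) under the bookkeeping hypothesis that `Q`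
divides the image of some nonzero rational polynomial. Here that hypothesis is discharged for every
nonzero `Q ∈ K[X]` (`exists_dvd_map_of_ne_zero`: induction on the factorisation of `Q`; an
irreducible factor is, up to a unit, the minimal polynomial over `K` of one of its roots `θ` in an
algebraic closure, which divides the image of the minimal polynomial of `θ` over `ℚ`), so that every
box representation of dimension one with a `K`-rational integrand without poles on `[0,1]` is a mixed
normal form (`nfD_of_algK`). This is the form in which an affine change of variables with ALGEBRAIC
end points delivers a rational representation on a bounded interval (file `…DimOnePiece`).

Sources: M. Kontsevich, D. Zagier, *Periods* (2001), §1.2; A. Baker, *Transcendental Number Theory*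
(1975), Thm. 2.1 (through `nfD_eq_zero_of_eval_eq_zero`). No definitions are introduced.
-/

noncomputable section

open MeasureTheory Set Finset
open scoped Polynomial
open Literature.NumberTheory.Transcendental Literature.NumberTheory.Transcendental.KZ
open Literature.ModelTheory.ExponentialFields (IsSemialgebraic isSemialgebraic_univ)

namespace Summit.KontsevichZagierPeriods.HurwitzMicroSectors.NormalFormPrinciple.PiBox

namespace Dlog

/-! ## Every nonzero polynomial over the real algebraic numbers divides a rational one -/

/-- **Irreducible case.** An irreducible `p ∈ K[X]` (`K` the real algebraic numbers) divides, in
`K[X]`, the image of a nonzero rational polynomial: a root `θ` of `p` in an algebraic closure of `K`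
is integral over `ℚ` (`K/ℚ` being algebraic), `p` is a unit multiple of `minpoly K θ`, and
`minpoly K θ ∣ (minpoly ℚ θ).map (algebraMap ℚ K)`. [folklore] -/
theorem exists_dvd_map_of_irreducible (p : (algebraicClosure ℚ ℝ)[X]) (hp : Irreducible p) :
    ∃ q₀ : ℚ[X], q₀ ≠ 0 ∧ p ∣ q₀.map (algebraMap ℚ (algebraicClosure ℚ ℝ)) := by
  obtain ⟨θ, hθ⟩ := IsAlgClosed.exists_aeval_eq_zero_of_injective
    (AlgebraicClosure (algebraicClosure ℚ ℝ))
    (algebraMap (algebraicClosure ℚ ℝ) (AlgebraicClosure (algebraicClosure ℚ ℝ))).injective p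
    (Polynomial.degree_pos_of_irreducible hp).ne'
  have hθa : IsAlgebraic (algebraicClosure ℚ ℝ) θ := ⟨p, hp.ne_zero, hθ⟩
  have hθK : IsIntegral (algebraicClosure ℚ ℝ) θ := hθa.isIntegral
  haveI : Algebra.IsAlgebraic ℚ (algebraicClosure ℚ ℝ) := algebraicClosure.isAlgebraic ℚ ℝ
  haveI : Algebra.IsIntegral ℚ (algebraicClosure ℚ ℝ) :=
    Algebra.isAlgebraic_iff_isIntegral.mp inferInstance
  have hθQ : IsIntegral ℚ θ := isIntegral_trans θ hθK
  refine ⟨minpoly ℚ θ, minpoly.ne_zero hθQ, ?_⟩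
  have h1 : p * Polynomial.C p.leadingCoeff⁻¹ = minpoly (algebraicClosure ℚ ℝ) θ :=
    minpoly.eq_of_irreducible hp hθ
  have h2 : minpoly (algebraicClosure ℚ ℝ) θ ∣
      (minpoly ℚ θ).map (algebraMap ℚ (algebraicClosure ℚ ℝ)) :=
    minpoly.dvd_map_of_isScalarTower ℚ (algebraicClosure ℚ ℝ) θ
  rw [← h1] at h2
  exact dvd_of_mul_right_dvd h2

/-- **Every nonzero polynomial over the real algebraic numbers divides the image of a nonzero
rational polynomial** (induction on the factorisation in the principal ideal domain `K[X]`).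
[folklore] -/
theorem exists_dvd_map_of_ne_zero (q : (algebraicClosure ℚ ℝ)[X]) (hq : q ≠ 0) :
    ∃ q₀ : ℚ[X], q₀ ≠ 0 ∧ q ∣ q₀.map (algebraMap ℚ (algebraicClosure ℚ ℝ)) := by
  induction q using WfDvdMonoid.induction_on_irreducible with
  | zero => exact absurd rfl hq
  | unit u hu => exact ⟨1, one_ne_zero, by rw [Polynomial.map_one]; exact hu.dvd⟩
  | mul a p ha hp ih =>
    obtain ⟨qa, hqa0, hqa⟩ := ih ha
    obtain ⟨qp, hqp0, hqp⟩ := exists_dvd_map_of_irreducible p hp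
    exact ⟨qp * qa, mul_ne_zero hqp0 hqa0, by rw [Polynomial.map_mul]; exact mul_dvd_mul hqp hqa⟩

/-! ## Box representations with `K`-rational integrands are mixed normal forms -/

variable {RA : ℝ → ℝ → ℝ → IntegralRep 1} {ZA : ℝ → IntegralRep 0} {RG : ℝ → ℝ → IntegralRep 1}

/-- **A box representation of dimension one with a `K`-rational integrand is a mixed normal form.**
If `N = [(0,1), P/Q]` with `P, Q ∈ K[X]` (`K` the real algebraic numbers) and `Q` without zeros on
`[0,1]`, then the class of `N` modulo the Kontsevich–Zagier relations is a mixed normal form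
`[pt, r] + Σ Λ(uⱼ, cⱼ) + Σ T(t_l, d_l)` (`nfD_of_dvd`, the divisibility bookkeeping being supplied by
`exists_dvd_map_of_ne_zero`). [cite: KontsevichZagier2001, §1.2] -/
theorem nfD_of_algK
    (hR : ∀ a b c, IsAlgebraic ℚ a → IsAlgebraic ℚ b → IsAlgebraic ℚ c → 0 < a →
      (RA a b c).domain = {x | x 0 ∈ Set.Ioo a b} ∧ (RA a b c).integrand = fun x => c / x 0)
    (hZ : ∀ r, IsAlgebraic ℚ r → (ZA r).domain = univ ∧ (ZA r).integrand = fun _ => r)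
    (hRG : ∀ t d, IsAlgebraic ℚ t → IsAlgebraic ℚ d →
      (RG t d).domain = {x | x 0 ∈ Set.Ioo 0 t} ∧ (RG t d).integrand = fun x => d / (1 + x 0 ^ 2))
    (P Q : (algebraicClosure ℚ ℝ)[X]) (hQ : ∀ t ∈ Set.Icc (0:ℝ) 1, (Polynomial.aeval t Q : ℝ) ≠ 0)
    (N : IntegralRep 1) (hNd : N.domain = {x | x 0 ∈ Set.Ioo (0:ℝ) 1})
    (hNi : EqOn N.integrand (fun x => (Polynomial.aeval (x 0) P : ℝ) / Polynomial.aeval (x 0) Q)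
      N.domain) :
    ∃ (r : ℝ) (k : ℕ) (u c : Fin k → ℝ) (k' : ℕ) (t d : Fin k' → ℝ), IsAlgebraic ℚ r ∧ (∀ j, 1 < u j) ∧
      (∀ j, IsAlgebraic ℚ (u j)) ∧ (∀ j, IsAlgebraic ℚ (c j)) ∧ (∀ l, 0 ≤ t l) ∧
      (∀ l, IsAlgebraic ℚ (t l)) ∧ (∀ l, IsAlgebraic ℚ (d l)) ∧
      QuotientAddGroup.mk' relations (of N) = QuotientAddGroup.mk' relations (of (ZA r)) +
        ∑ j, QuotientAddGroup.mk' relations (of (RA 1 (u j) (c j))) +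
        ∑ l, QuotientAddGroup.mk' relations (of (RG (t l) (d l))) := by
  have hQ0 : Q ≠ 0 := fun h => hQ 0 ⟨le_rfl, zero_le_one⟩ (by rw [h, map_zero])
  obtain ⟨q₀, hq₀, hdvd⟩ := exists_dvd_map_of_ne_zero Q hQ0
  exact nfD_of_dvd hR hZ hRG hq₀ _ P Q N hQ0 le_rfl hdvd hQ hNd hNi

end Dlog

end Summit.KontsevichZagierPeriods.HurwitzMicroSectors.NormalFormPrinciple.PiBox
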